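import Literature.Probability.Percolation.SeededFrontier
import HarnessLib

/-!
# The seeds of the collar exploration: the strip `K` docked to the explored far side

Topic `Literature/Probability/Percolation`; definitions-and-proofs support file (no named fact)
for the mesh-independent gluing Proposition 4.1 of O. Schramm, S. Smirnov, *On the scaling limits
of planar percolation*, Ann. Probab. 39 (2011), arXiv:1101.5820, §4 (p. 17: "let `K` be the
closure of the union of connected components of `[Q₀] ∖ (⋃ᵢ B(xᵢ, s) ∪ β ∪ β')` whose boundary
intersects both `β` and `β'` … each component `K_j` of `K` is a quad with two 'long' sides on `β`
and `β'`"; p. 18: "we start on the curve `β` and explore all the potential crossings of the strip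
between `β` and `β'`").

For bond percolation on `ℤ²` the strip is a finite set `K` of lattice sites and the explored far
side a set `Far` of sites (the lattice points beyond `β`, explored wholesale, together with the
outside of the window); everything else — the fresh tube beyond `β'` and the excised squares — is
simply "not in `K ∪ Far`".  `CollarDatum.seeds` turns the pair `(K, Far)` into seeds for the
boundary-interface explorer of `SeededExplorer.lean`:

* examinable edges `A` = lattice edges with an endpoint in `K` and both endpoints in `K ∪ Far`
  (the edges of the strip and its top legs; the bottom legs towards the fresh side are NOT
  examinable — the interfaces stop on `β'` as in the source, `not_mem_A_of_not_mem`);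
* seed sites `O₀ = Far`, seed faces `D₀` = the faces with a corner in `Far`.

Proved: membership lemmas; all four lattice edges at a site of `K` whose neighbours lie in
`K ∪ Far` are examinable (`mem_A_of_forall_neighbours`, the hypothesis of the docking lemma
`IsTerminal.exists_isBeachEdge_of_fresh`); the explored clusters stay in the strip and the far
side: `𝒪 ⊆ K ∪ Far` (`mem_union_of_oReach`), every face of `𝒟` has a corner in `K ∪ Far`
(`exists_corner_of_dReach`), so that faces all of whose corners are fresh are never in `𝒟`
(`not_dReach_of_forall_corner`) — the fresh tube is invisible to the exploration.

## References

* O. Schramm, S. Smirnov, Ann. Probab. 39 (2011) 1768–1814, arXiv:1101.5820, §4, proof of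
  Prop. 4.1 ("Setup for the neighborhood of α", "Bays and beaches"). [SchrammSmirnov2011]

Tree: `Seeded.Seeds`, `Seeded.OReach`, `Seeded.DReach`, `Seeded.exists_mem_of_oReach`,
`Seeded.exists_mem_of_dReach` (`SeededExplorer.lean`, `SeededFrontier.lean`); `latticeEdgesAt`,
`mem_latticeEdgesAt_of_mem`, `mem_edgeSet_of_mem_latticeEdgesAt`, `mem_of_mem_latticeEdgesAt`,
`TouchesFace`, `touchesFace_of_isFaceOf` (`LatticeFaceParity.lean`).
-/

noncomputable section

namespace Literature.Probability.Percolation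

open LatticeModels Relation
open scoped Classical

namespace Seeded

/-! ### The collar datum -/

/-- **A collar datum**: the finite set `K` of sites of the strip and the set `Far` of explored
far sites, disjoint. [cite: SchrammSmirnov2011, §4, proof of Prop. 4.1 (the strip K between β and β')] -/
structure CollarDatum where
  /-- the sites of the strip `K` -/
  K : Finset (Site 2)
  /-- the explored far sites (beyond `β`, and outside the window) -/
  Far : Set (Site 2)
  /-- the strip and the far side are disjoint -/
  disjoint : ∀ v ∈ K, v ∉ Far

namespace CollarDatum

variable (𝒞 : CollarDatum)

/-- **The examinable edges of the collar**: lattice edges with an endpoint in `K` and both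
endpoints in `K ∪ Far` (edges of the strip and its top legs; bottom legs excluded).
[cite: SchrammSmirnov2011, §4, proof of Prop. 4.1 ("percolation interface in the interior of K")] -/
def A : Finset (Sym2 (Site 2)) :=
  (𝒞.K.biUnion latticeEdgesAt).filter fun e => ∀ v ∈ e, v ∈ 𝒞.K ∨ v ∈ 𝒞.Far

/-- **The seed faces**: faces with a corner in `Far`. [cite: SchrammSmirnov2011, §4, proof of Prop. 4.1 (interfaces with an endpoint on β)] -/
def D₀ : Set (Site 2) := {f | ∃ v : Site 2, TouchesFace v f ∧ v ∈ 𝒞.Far}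

/-- Membership in the examinable edges. [folklore] -/
theorem mem_A_iff {e : Sym2 (Site 2)} :
    e ∈ 𝒞.A ↔ e ∈ (zdGraph 2).edgeSet ∧ (∃ v ∈ e, v ∈ 𝒞.K) ∧ ∀ v ∈ e, v ∈ 𝒞.K ∨ v ∈ 𝒞.Far := by
  rw [A, Finset.mem_filter, Finset.mem_biUnion]
  constructor
  · rintro ⟨⟨v, hvK, he⟩, hall⟩
    exact ⟨mem_edgeSet_of_mem_latticeEdgesAt he, ⟨v, mem_of_mem_latticeEdgesAt he, hvK⟩, hall⟩
  · rintro ⟨he, ⟨v, hve, hvK⟩, hall⟩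
    exact ⟨⟨v, hvK, mem_latticeEdgesAt_of_mem he hve⟩, hall⟩

/-- **The seeds of the collar exploration.** [cite: SchrammSmirnov2011, §4, proof of Prop. 4.1 ("we start on the curve β and explore")] -/
def seeds : Seeds where
  A := 𝒞.A
  O₀ := 𝒞.Far
  D₀ := 𝒞.D₀
  A_subset _ he := (𝒞.mem_A_iff.1 he).1

/-- The examinable edges of the seeds. [folklore] -/
@[simp] theorem seeds_A : 𝒞.seeds.A = 𝒞.A := rfl
/-- The seed sites of the seeds. [folklore] -/
@[simp] theorem seeds_O₀ : 𝒞.seeds.O₀ = 𝒞.Far := rfl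
/-- The seed faces of the seeds. [folklore] -/
@[simp] theorem seeds_D₀ : 𝒞.seeds.D₀ = 𝒞.D₀ := rfl

/-! ### Which edges are examinable -/

/-- **Bottom legs and fresh edges are not examinable**: an edge with an endpoint outside
`K ∪ Far` is not in `A` ("the interfaces stop on `β'`"). [cite: SchrammSmirnov2011, §4, proof of Prop. 4.1 (interfaces in the interior of K)] -/
theorem not_mem_A_of_not_mem {e : Sym2 (Site 2)} {v : Site 2} (hv : v ∈ e) (hK : v ∉ 𝒞.K)
    (hF : v ∉ 𝒞.Far) : e ∉ 𝒞.A := fun he =>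
  ((𝒞.mem_A_iff.1 he).2.2 v hv).elim hK hF

/-- Examinable edges join sites of `K ∪ Far`. [folklore] -/
theorem mem_or_mem_of_mem_A {e : Sym2 (Site 2)} (he : e ∈ 𝒞.A) {v : Site 2} (hv : v ∈ e) :
    v ∈ 𝒞.K ∨ v ∈ 𝒞.Far :=
  (𝒞.mem_A_iff.1 he).2.2 v hv

/-- **All four edges at an interior site of the strip are examinable**: if `v ∈ K` and every
lattice neighbour of `v` lies in `K ∪ Far`. [folklore] -/
theorem mem_A_of_forall_neighbours {v : Site 2} (hvK : v ∈ 𝒞.K)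
    (hnb : ∀ w, (zdGraph 2).Adj v w → w ∈ 𝒞.K ∨ w ∈ 𝒞.Far) :
    ∀ g ∈ (zdGraph 2).edgeSet, v ∈ g → g ∈ 𝒞.A := by
  intro g hg hvg
  induction g using Sym2.ind with
  | _ x y =>
    have hxy : (zdGraph 2).Adj x y := (SimpleGraph.mem_edgeSet (G := zdGraph 2)).1 hg
    refine 𝒞.mem_A_iff.2 ⟨hg, ⟨v, hvg, hvK⟩, fun w hw => ?_⟩
    rcases Sym2.mem_iff.1 hvg with rfl | rfl
    · rcases Sym2.mem_iff.1 hw with rfl | rfl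
      · exact Or.inl hvK
      · exact hnb w hxy
    · rcases Sym2.mem_iff.1 hw with rfl | rfl
      · exact hnb w hxy.symm
      · exact Or.inl hvK

/-! ### Where the explored clusters live -/

variable {𝒞}

/-- **`𝒪 ⊆ K ∪ Far`**: the explored open clusters stay in the strip and the far side (seeds are
far; examined edges are examinable). [folklore] -/
theorem mem_union_of_oReach {X : Finset (Sym2 (Site 2))} (hX : X ⊆ 𝒞.A) {ω : BondConfig (Site 2)}
    {v : Site 2} (hv : OReach 𝒞.seeds X ω v) : v ∈ 𝒞.K ∨ v ∈ 𝒞.Far := by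
  rcases exists_mem_of_oReach hv with h | ⟨e, heX, -, hve⟩
  · exact Or.inr h
  · exact 𝒞.mem_or_mem_of_mem_A (hX heX) hve

/-- **Every face of `𝒟` has a corner in `K ∪ Far`** (seed faces have a far corner; other faces
of `𝒟` are faces of examined, hence examinable, edges). [folklore] -/
theorem exists_corner_of_dReach {X : Finset (Sym2 (Site 2))} (hX : X ⊆ 𝒞.A) {ω : BondConfig (Site 2)}
    {f : Site 2} (hf : DReach 𝒞.seeds X ω f) : ∃ v : Site 2, TouchesFace v f ∧ (v ∈ 𝒞.K ∨ v ∈ 𝒞.Far) := by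
  rcases exists_mem_of_dReach hf with ⟨v, hv, hvF⟩ | ⟨e, heX, -, hfe⟩
  · exact ⟨v, hv, Or.inr hvF⟩
  · have he := hX heX
    obtain ⟨v, hve, hvK⟩ := (𝒞.mem_A_iff.1 he).2.1
    exact ⟨v, touchesFace_of_isFaceOf (𝒞.mem_A_iff.1 he).1 hfe hve, Or.inl hvK⟩

/-- **The fresh tube is invisible**: a face all of whose corners are off `K ∪ Far` is never in
`𝒟`. [cite: SchrammSmirnov2011, §4, proof of Prop. 4.1 (the restriction of ω to M' is unbiased)] -/
theorem not_dReach_of_forall_corner {X : Finset (Sym2 (Site 2))} (hX : X ⊆ 𝒞.A) {ω : BondConfig (Site 2)}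
    {f : Site 2} (hf : ∀ v : Site 2, TouchesFace v f → v ∉ 𝒞.K ∧ v ∉ 𝒞.Far) :
    ¬ DReach 𝒞.seeds X ω f := by
  intro hD
  obtain ⟨v, hv, h⟩ := exists_corner_of_dReach hX hD
  rcases h with h | h
  · exact (hf v hv).1 h
  · exact (hf v hv).2 h

/-- The examined edges of the collar exploration are examinable. [folklore] -/
theorem examined_subset_A (ω : BondConfig (Site 2)) : examined 𝒞.seeds ω ⊆ 𝒞.A :=
  examined_subset ω

/-- **Docking in the interior of the strip happens at beach vertices**: at termination, a site
`v ∈ K` of `𝒪` all of whose neighbours lie in `K ∪ Far`, carrying a fresh examinable edge, is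
an endpoint of a beach edge (`IsTerminal.exists_isBeachEdge_of_fresh` with
`mem_A_of_forall_neighbours`). [cite: SchrammSmirnov2011, §4, proof of Prop. 4.1 (bays and beaches)] -/
theorem exists_isBeachEdge_of_fresh_interior {X : Finset (Sym2 (Site 2))} {ω : BondConfig (Site 2)}
    (hT : IsTerminal 𝒞.seeds X ω) {v : Site 2} (hvK : v ∈ 𝒞.K)
    (hnb : ∀ w, (zdGraph 2).Adj v w → w ∈ 𝒞.K ∨ w ∈ 𝒞.Far) (hO : OReach 𝒞.seeds X ω v)
    {e : Sym2 (Site 2)} (he : e ∈ 𝒞.A) (heX : e ∉ X) (hve : v ∈ e) :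
    ∃ g, v ∈ g ∧ IsBeachEdge 𝒞.seeds X ω g :=
  hT.exists_isBeachEdge_of_fresh hO (𝒞.disjoint v hvK) (𝒞.mem_A_of_forall_neighbours hvK hnb) he heX hve

end CollarDatum

end Seeded

end Literature.Probability.Percolation
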